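import Literature.Probability.Percolation.NearCriticalExpDecay
import Literature.Probability.Percolation.NearCriticalRSW
import Literature.Probability.Percolation.NearCriticalScalingLeaves
import Literature.Probability.Percolation.KestenScalingThetaFromFourFacts
import Literature.Probability.Percolation.FiveArmLowerBound
import Literature.Probability.Percolation.HalfPlaneTwoArmRadiiNearCritical
import HarnessLib

/-!
# The subcritical radius decay beyond `L_ε(p)` for every `ε`: reductions (proofs only)

Topic `Literature/Probability/Percolation`; family `crit-perc`. Proof file accompanying
`NearCriticalCorrelationLength.lean` (no new definition, no new named fact), recording the state of
the discharge of the named fact `Nolin2008_radius_decay_subcritical` (Nolin 2008, §7.5, proof of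
Lemma 44 [arXiv 0711.4948: Lemma 42], first annulus display: for `p < 1/2`,
`P_p(∂S_L ↝ ∂S_{kL}) ≤ C₃ e^{-C₄ k}`, `L = L_ε(p)`, "a direct consequence of the exponential decay
property (7.20) for longer parallelograms" — for EVERY `ε ∈ (0, 1/2)`, the value of `ε` being
arbitrary in Nolin's §7 by the equivalence of lengths). Companion of the sibling file
`NearCriticalCorrelationLengthProofs.lean` (the supercritical half:
`Nolin2008_radius_decay_supercritical_of_lemma39`, `Nolin2008_radius_decay_of_lemma39`,
`Nolin2008_radius_decay_supercritical_at_anti`).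

## The printed proof and what the tree has

Nolin's Lemma 39 with Remark 40 [arXiv: Lemma 37, Remark 38] (uniform exponential decay of
easy-way crossings beyond `L_ε(p)`) gives the display at once
(`Nolin2008_radius_decay_subcritical_at_of_lemma39_at`, `NearCriticalCorrelationLength.lean`,
proved). Lemma 39 itself is proved by Nolin in two steps (arXiv p. 26): (i) for `ε` below a
threshold `ε₀` given by the Russo–Seymour–Welsh theorem, by the block argument — in the tree:
`Nolin2008_lemma39_at_of_RSW_one` (`NearCriticalExpDecay.lean`) and `Nolin2008_lemma39_at_small`
(`NearCriticalRSW.lean`), both from the "moreover" clause `Nolin2008_RSW_one` of the RSW theorem;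
(ii) "The result for any `ε ∈ (0,1/2)` follows readily by using the equivalence of lengths for
different values of `ε` (Corollary 35)", `L_ε(p) ≍ L_{ε'}(p)`, whose proof uses Kesten's relation
`|p - 1/2| L_ε(p)² π₄(L_ε(p)) ≍ 1` (Prop. 32 [EJP: Prop. 34], the tree's `Nolin2008_prop34`),
quasi-multiplicativity and the a-priori bound for four arms from the five-arm exponent. Nolin
stresses (after the proof of Lemma 37) that the direct argument gives the decay "only for values
of `ε` small enough". Note the direction: the statement at `ε` implies the statement at every
`ε' ≤ ε` (`L_ε ≤ L_{ε'}`, arm events decrease with the radius; far from `1/2` the plain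
sub-critical decay takes over), so the content of the all-`ε` fact beyond the RSW theorem is
exactly its content at `ε` close to `1/2`.

Accordingly this file PROVES:
* `Nolin2008_radius_decay_subcritical_of_lemma39` — the fact for every `ε ∈ (0, 1/2)` from the
  tree's named fact `Nolin2008_lemma39` (`NearCriticalArm.lean`, every `ε`). The discharge
  `Nolin2008_radius_decay_subcritical_holds` is this theorem applied to `Nolin2008_lemma39_holds`
  once that lands.
* `Nolin2008_radius_decay_subcritical_at_of_RSW_one` / `…_of_RSW_thm` — step (i): the fact at
  every `ε ≤ ε₀` from the RSW theorem at general `p` alone (both halves: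
  `Nolin2008_radius_decay_at_of_RSW_one`, `TriCorrLengthLeaves.lean`).
* `Nolin2008_radius_decay_subcritical_at_anti`, `Nolin2008_radius_decay_subcritical_of_near_half` —
  monotonicity in `ε` (with the sub-critical exponential decay of the radius,
  `BollobasRiordan2006_tri_expDecay_holds`, on `p ≤ ε`, and `S_N`-arms inside hexagon arms,
  `triBoxArm_subset_triOneArm`): the all-`ε` fact is equivalent to its instances at `ε`
  arbitrarily close to `1/2`.
* `Nolin2008_radius_decay_subcritical_at_of_charLength_le` — step (ii), the glue, PROVED: the decay
  beyond `L_{ε₀}` and a comparison `L_{ε₀}(p) ≤ M L_ε(p)` give the decay beyond `L_ε` (constants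
  `max C 1 · e^{c}`, `c / M`); and `Nolin2008_radius_decay_subcritical_of_small_of_lengths` /
  `…_of_RSW_one_of_lengths` — every `ε ∈ (0, 1/2)` from step (i) and the non-trivial direction of
  Cor. 35 near `p = 1/2⁻` (taken as a HYPOTHESIS, stated with `charLength`; the extension from a
  left neighbourhood of `1/2` to all `p < 1/2` is done here, by the monotonicity of `L_ε` in `p`,
  `charLength_le_mul_charLength_of_eventually`).

What is NOT here: Cor. 35 itself (a theory of its own: Kesten's relation, arm separation,
quasi-multiplicativity, the universal five-arm exponent), and the RSW clause `Nolin2008_RSW_one`.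

## After the unconditional start (sequel section)

Since the above was written the START of Nolin's block argument became a theorem of the tree:
`Nolin2008_lemma39_at_holds_small` (`NearCriticalRSWStart.lean`; the two-scale
Russo–Seymour–Welsh bounds of Bollobás–Riordan iterated in lattice hexagons, `TriRSWRounds.lean`)
proves `Nolin2008_lemma39_at ε` for every `ε ≤ ε₀`, with no hypothesis. The last section of this
file draws the consequences for the present fact:
* `Nolin2008_radius_decay_subcritical_at_holds_small` — **the fact PROVED at every `ε ≤ ε₀`**
  (step (i) closed): `∃ ε₀ > 0, ∀ ε ≤ ε₀, Nolin2008_radius_decay_subcritical_at ε`;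
* `Nolin2008_radius_decay_subcritical_of_lengths` (and the `ℕ`-shaped
  `Nolin2008_radius_decay_subcritical_of_lengths'`) — for every `ε ∈ (0, 1/2)` the fact now
  follows from the SINGLE remaining input, the non-trivial inequality `L_{ε₀}(p) ≤ C L_ε(p)`
  (`0 < ε₀ < ε < 1/2`, `p` just below `1/2`) of Cor. 37 [arXiv: Cor. 35];
* `Nolin2008_radius_decay_subcritical_of_scaling` / `…_of_lemma62` — hence from the three named
  facts of the printed proof of Cor. 37: Kesten's relation `Nolin2008_prop34` (or Werner's pivotal
  count `Werner2009_lemma62`, whence `Nolin2008_prop34` by `Nolin2008_prop34_of_expDecay`),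
  quasi-multiplicativity `Werner2009_fourArm_quasiMult` and the a-priori four-arm lower bound
  `Werner2009_fourArm_lowerBound` (through `charLength_lengths_of_prop34`,
  `Nolin2008_lemma39_of_lengths`, `Nolin2008_lemma39_of_lemma62`). The discharge
  `Nolin2008_radius_decay_subcritical_holds` is `Nolin2008_radius_decay_subcritical_of_lemma62`
  applied to the three `_holds` once they land (equivalently `…_of_lemma39 Nolin2008_lemma39_holds`).
No Russo–Seymour–Welsh statement at `p ≠ 1/2` remains among the leaves.

## After the discharge of two of Werner's four facts (second sequel)

Two of the four named facts of Kesten's near-critical arm calculus in Werner's form have since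
become theorems of the tree — `Werner2009_fourArm_lowerBound_holds` (`FiveArmLowerBound.lean`: the
five-arm lower bound `c (m/n)²` below `L(p)` and Reimer's inequality) and
`Werner2009_halfPlane_twoArm_holds` (`HalfPlaneTwoArmRadiiNearCritical.lean`) — and
`KestenScalingThetaFromFourFacts.lean` assembled Lemma 39 at every `ε` from the four
(`Nolin2008_lemma39_of_facts4`). The last two theorems of this file record the consequence for the
present fact:
* `Nolin2008_radius_decay_subcritical_of_lemma62_of_quasiMult` — the fact from Werner's rhombus
  pivotal count `Werner2009_lemma62` and the quasi-multiplicativity `Werner2009_fourArm_quasiMult`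
  (the a-priori bound of `…_of_lemma62` being discharged);
* `Nolin2008_radius_decay_subcritical_of_facts2` — **the fact from exactly the two remaining named
  facts** `Werner2009_fourArm_quasiMult` (Werner 2009, Lecture 6, Cor. 6.2: quasi-multiplicativity
  of four arms below `L(p)`) and `Werner2009_pivotal_lowerBound` (proof of Lemma 6.2: interior
  sites of the `2N × N` parallelogram are pivotal with probability `≥ cst · π̂_p(N)` below `L(p)`),
  both consequences of Kesten's separation of four arms below `L(p)` (Werner, Prop. 6.1; Nolin,
  Thm. 11, Props. 12–13 [arXiv: Thm. 10, Props. 11–12]), neither in the tree yet. The discharge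
  `Nolin2008_radius_decay_subcritical_holds` is `Nolin2008_radius_decay_subcritical_of_facts2`
  applied to `Werner2009_fourArm_quasiMult_holds` and `Werner2009_pivotal_lowerBound_holds` once
  these land.

## References

* P. Nolin, Near-critical percolation in two dimensions, *Electron. J. Probab.* 13 (2008),
  §7.3 Cor. 37, §7.4 Lemma 39 / Remark 40, §7.5 proof of Lemma 44 (EJP numbering; arXiv
  0711.4948: Cor. 35, Lemma 37 / Remark 38, Lemma 42; arXiv p. 26 for the two-step proof of
  Lemma 37 and p. 29 for the annulus displays) [Nolin2008].
* B. Bollobás, O. Riordan, *Percolation*, CUP (2006), Ch. 4, Thm. 9 with Ch. 5, Thm. 8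
  (exponential decay below `p_c = 1/2`) [BollobasRiordan2006].
* H. Kesten, Scaling relations for 2D-percolation, *Comm. Math. Phys.* 109 (1987) [KestenScalingCMP1987].

## Mathlib / tree

Mathlib: `Real.exp`, `Nat.div_add_mod`; no percolation. Tree: `Nolin2008_radius_decay_subcritical(_at)`,
`Nolin2008_radius_decay_subcritical_at_of_lemma39_at`, `triBoxArm_anti`, `mem_triBoxArm_iff`,
`mem_triOneArm_of_pathIn_of_le_triNorm` (`NearCriticalCorrelationLength.lean`);
`Nolin2008_lemma39_at_of_lemma39`, `Nolin2008_lemma39_at_of_RSW_one` (`NearCriticalExpDecay.lean`);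
`Nolin2008_subcritical_crossing_holds`, `one_le_charLength` (`NearCriticalRSW.lean`);
`BollobasRiordan2006_tri_expDecay_holds` (`TriSubcriticalCrossingProofs.lean`);
`sitePercolation_real_mono`, `determinedBy_exitEvent`, `isUpperSet_exitEvent`
(`SiteMonotonicity.lean`); `charLength_le_charLength`, `triLRCrossingProb_charLength_le'`,
`min_symm_eq_self` (`KestenRelationRusso.lean`); `Nolin2008_RSW_one_of_RSW_thm`
(`NearCriticalCorrelationLengthLower.lean`); `Nolin2008_lemma39_at_holds_small` (`NearCriticalRSWStart.lean`),
`Nolin2008_lemma39_of_lengths`, `Nolin2008_lemma39_of_lemma62` (`NearCriticalScalingLeaves.lean`),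
`charLength_lengths_of_prop34` (`CharLengthEquivalence.lean`); `Nolin2008_lemma39_of_facts4`
(`KestenScalingThetaFromFourFacts.lean`), `Werner2009_fourArm_lowerBound_holds` (`FiveArmLowerBound.lean`),
`Werner2009_halfPlane_twoArm_holds` (`HalfPlaneTwoArmRadiiNearCritical.lean`).
-/

noncomputable section

open MeasureTheory Set
open scoped unitInterval

namespace Literature.Probability.Percolation

open LatticeModels

/-! ### Every `ε` from the tree's Lemma 39 -/

/-- **`Nolin2008_radius_decay_subcritical` from Nolin's Lemma 39 for every `ε`.** The tree's
named fact `Nolin2008_lemma39` (`NearCriticalArm.lean`: Lemma 39 with Remark 40 for every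
`ε ∈ (0, 1/2)`) gives `Nolin2008_lemma39_at ε` (`Nolin2008_lemma39_at_of_lemma39`) and hence the
first annulus display of the proof of Lemma 44 for the finite cluster of the origin
(`Nolin2008_radius_decay_subcritical_at_of_lemma39_at`), for every `ε ∈ (0, 1/2)`. [cite: Nolin2008, §7.5, proof of Lemma 44 (arXiv 0711.4948: Lemma 42), first annulus display; §7.4 Lemma 39 / Remark 40 (arXiv: Lemma 37 / Remark 38)] -/
theorem Nolin2008_radius_decay_subcritical_of_lemma39 (h : Nolin2008_lemma39) :
    Nolin2008_radius_decay_subcritical := fun _ε hε hε' =>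
  Nolin2008_radius_decay_subcritical_at_of_lemma39_at (Nolin2008_lemma39_at_of_lemma39 h hε hε')

/-! ### Small `ε` from the Russo–Seymour–Welsh theorem (Nolin's step (i)) -/

/-- **The subcritical radius decay at every `ε ≤ ε₀` from `Nolin2008_RSW_one`**: the "moreover"
clause of the RSW theorem starts the block argument (`Nolin2008_lemma39_at_of_RSW_one`), whence
Lemma 39 and the annulus display at every `ε` below the RSW threshold `ε₀ > 0` (Nolin: "we have
proved the property for any `ε` below some fixed value `ε₀` (given by RSW)"). [cite: Nolin2008, §7.4, proof of Lemma 39 (arXiv 0711.4948: Lemma 37, p. 26); §7.5, proof of Lemma 44 (arXiv: Lemma 42)] -/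
theorem Nolin2008_radius_decay_subcritical_at_of_RSW_one (h : Nolin2008_RSW_one) :
    ∃ ε₀ > (0 : ℝ), ∀ ε : ℝ, ε ≤ ε₀ → Nolin2008_radius_decay_subcritical_at ε := by
  obtain ⟨ε₀, hε₀, h37⟩ := Nolin2008_lemma39_at_of_RSW_one h
  exact ⟨ε₀, hε₀, fun ε hε => Nolin2008_radius_decay_subcritical_at_of_lemma39_at (h37 ε hε)⟩

/-- **The subcritical radius decay at every `ε ≤ ε₀` from Nolin's RSW theorem as printed**
(`Nolin2008_RSW_thm`, the functions `f_k` with `f_k(δ) → 1`). [cite: Nolin2008, §3.1 Thm. "Russo–Seymour–Welsh" (arXiv 0711.4948: Thm. 2); §7.4, proof of Lemma 39 (arXiv: Lemma 37)] -/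
theorem Nolin2008_radius_decay_subcritical_at_of_RSW_thm (h : Nolin2008_RSW_thm) :
    ∃ ε₀ > (0 : ℝ), ∀ ε : ℝ, ε ≤ ε₀ → Nolin2008_radius_decay_subcritical_at ε :=
  Nolin2008_radius_decay_subcritical_at_of_RSW_one (Nolin2008_RSW_one_of_RSW_thm h)

/-! ### Monotonicity in `ε`: the fact reduces to `ε` close to `1/2` -/

/-- **`{0 ↝ ∂S_N} ⊆ {0 ↔ ∂Λ_N}`** (`N ≥ 1`): the hexagon `Λ_N` lies inside the rhombus `S_N`
(`|y_i| ≤ ‖y‖_𝕋`), so an open path from `0` to `∂S_N` passes through `∂Λ_N`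
(`mem_triOneArm_of_pathIn_of_le_triNorm`). [folklore] -/
theorem triBoxArm_subset_triOneArm {N : ℕ} (hN : 1 ≤ N) : triBoxArm N ⊆ triOneArm N := by
  intro ω hω
  obtain ⟨y, -, ⟨i, hi⟩, hωy⟩ := mem_triBoxArm_iff.1 hω
  refine mem_triOneArm_of_pathIn_of_le_triNorm
    ((PathIn.of_mem_siteConnIn hωy).mono inter_subset_right) hN ?_
  have key : ∀ j : Fin 2, |y j| ≤ triNorm y := by
    intro j
    fin_cases j
    · exact le_max_left _ _
    · exact (le_max_left _ _).trans (le_max_right _ _)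
  rw [← hi]
  exact key i

/-- **Monotonicity in `ε` of the subcritical radius decay.** If
`Nolin2008_radius_decay_subcritical_at ε` holds and `0 < ε' ≤ ε < 1/2`, then
`Nolin2008_radius_decay_subcritical_at ε'` holds. For `ε < p < 1/2`:
`1 ≤ L_ε(p) ≤ L_{ε'}(p)` (Nolin 2008, proof of Cor. 37 [arXiv: Cor. 35]: "assume that `ε ≤ ε'`, so
that `L_ε(p) ≥ L_{ε'}(p)`"), so `{0 ↝ ∂S_{k L_{ε'}(p)}} ⊆ {0 ↝ ∂S_{k L_ε(p)}}` (`triBoxArm_anti`).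
For `p ≤ ε` (where the statement at `ε` is void, `L_ε(p) = 0`): `P_p(0 ↝ ∂S_N) ≤ P_ε(0 ↔ ∂Λ_N)
≤ e^{-α N} ≤ e^{-α k}` by monotonicity in `p` (Grimmett 1999, Thm. 2.1) and the exponential decay
of the radius at the sub-critical parameter `ε` (Bollobás–Riordan 2006, Ch. 4, Thm. 9),
`N = k L_{ε'}(p) ≥ k`. Constants: `max C 1`, `min c α`. [cite: Nolin2008, §7.3, proof of Cor. 37 (arXiv 0711.4948: Cor. 35); §7.5, proof of Lemma 44 (arXiv: Lemma 42)] -/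
theorem Nolin2008_radius_decay_subcritical_at_anti {ε ε' : ℝ} (hε' : 0 < ε') (hle : ε' ≤ ε)
    (hε : ε < 1 / 2) (h : Nolin2008_radius_decay_subcritical_at ε) :
    Nolin2008_radius_decay_subcritical_at ε' := by
  obtain ⟨C, hC, c, hc, h⟩ := h
  have hsub := Nolin2008_subcritical_crossing_holds
  have hε0 : 0 < ε := hε'.trans_le hle
  -- the sub-critical parameter `ε` itself and the decay of the radius there
  have hεI : ε ∈ Icc (0 : ℝ) 1 := ⟨hε0.le, by linarith⟩
  set q : unitInterval := ⟨ε, hεI⟩ with hq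
  obtain ⟨α, hα, hdec⟩ := BollobasRiordan2006_tri_expDecay_holds q (show (ε : ℝ) < 1 / 2 from hε)
  refine ⟨max C 1, by positivity, min c α, lt_min hc hα, fun p hp hL' k hk => ?_⟩
  have hk0 : (0 : ℝ) ≤ k := Nat.cast_nonneg k
  by_cases hεp : ε < (p : ℝ)
  · -- `ε < p < 1/2`: the statement at `ε`, and `L_ε(p) ≤ L_{ε'}(p)`
    have hL : 1 ≤ charLength ε p := one_le_charLength hsub hε0 hεp hp
    have hLL : charLength ε p ≤ charLength ε' p := by
      have hmem : charLength ε' p ∈ {n : ℕ | triLRCrossingProb (min p (σ p)) n n ≤ ε} := by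
        rw [mem_setOf_eq, min_symm_eq_self hp.le]
        exact (triLRCrossingProb_charLength_le' hsub hε' hp).trans hle
      exact Nat.sInf_le hmem
    have hkL : 1 ≤ k * charLength ε p := le_trans hL (Nat.le_mul_of_pos_left _ hk)
    calc (triSitePercolation p).real
          (triBoxArm (k * charLength ε' p) ∩ (sitePercolatesAt triGraph 0)ᶜ)
        ≤ (triSitePercolation p).real
            (triBoxArm (k * charLength ε p) ∩ (sitePercolatesAt triGraph 0)ᶜ) :=
          measureReal_mono (inter_subset_inter_left _ (triBoxArm_anti hkL (Nat.mul_le_mul_left k hLL)))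
            (measure_ne_top _ _)
      _ ≤ C * Real.exp (-(c * k)) := h p hp hL k hk
      _ ≤ max C 1 * Real.exp (-(min c α * k)) := by
          gcongr
          · exact le_max_left _ _
          · exact min_le_left _ _
  · -- `p ≤ ε`: plain sub-critical decay at the parameter `ε`
    push Not at hεp
    have hpq : p ≤ q := Subtype.coe_le_coe.1 hεp
    set N := k * charLength ε' p with hN
    have hN1 : 1 ≤ N := le_trans hL' (Nat.le_mul_of_pos_left _ hk)
    have hkN : k ≤ N := by rw [hN]; exact Nat.le_mul_of_pos_right _ hL'
    have hkN' : (k : ℝ) ≤ N := by exact_mod_cast hkN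
    calc (triSitePercolation p).real (triBoxArm N ∩ (sitePercolatesAt triGraph 0)ᶜ)
        ≤ (triSitePercolation p).real (triBoxArm N) :=
          measureReal_mono inter_subset_left (measure_ne_top _ _)
      _ ≤ (triSitePercolation q).real (triBoxArm N) :=
          sitePercolation_real_mono (determinedBy_exitEvent _ _) (isUpperSet_exitEvent _ _) hpq
      _ ≤ (triSitePercolation q).real (triOneArm N) :=
          measureReal_mono (triBoxArm_subset_triOneArm hN1) (measure_ne_top _ _)
      _ ≤ Real.exp (-α * N) := hdec N hN1
      _ ≤ 1 * Real.exp (-(min c α * k)) := by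
          rw [one_mul]
          refine Real.exp_le_exp.2 ?_
          rw [neg_mul, neg_le_neg_iff]
          calc min c α * k ≤ α * k := mul_le_mul_of_nonneg_right (min_le_right _ _) hk0
            _ ≤ α * N := mul_le_mul_of_nonneg_left hkN' hα.le
      _ ≤ max C 1 * Real.exp (-(min c α * k)) :=
          mul_le_mul_of_nonneg_right (le_max_right _ _) (Real.exp_pos _).le

/-- **The all-`ε` fact from its instances near `1/2`.** If for every `η > 0` there is
`ε ∈ [1/2 - η, 1/2)` at which `Nolin2008_radius_decay_subcritical_at ε` holds, then
`Nolin2008_radius_decay_subcritical` holds (`Nolin2008_radius_decay_subcritical_at_anti`). [cite: Nolin2008, §7.3, proof of Cor. 37 (arXiv 0711.4948: Cor. 35); §7.5, proof of Lemma 44 (arXiv: Lemma 42)] -/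
theorem Nolin2008_radius_decay_subcritical_of_near_half
    (h : ∀ η : ℝ, 0 < η → ∃ ε : ℝ, 1 / 2 - η ≤ ε ∧ ε < 1 / 2 ∧
      Nolin2008_radius_decay_subcritical_at ε) :
    Nolin2008_radius_decay_subcritical := by
  intro ε' hε' hε'2
  obtain ⟨ε, hle, hε, hG⟩ := h (1 / 2 - ε') (by linarith)
  exact Nolin2008_radius_decay_subcritical_at_anti hε' (by linarith) hε hG

/-! ### From small `ε` to every `ε` through the comparison of lengths (Nolin's step (ii)) -/

/-- **Glue: radius decay beyond `L_{ε₀}` and `L_{ε₀} ≤ M · L_ε` give radius decay beyond `L_ε`.**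
If `P_p(0 ↝ ∂S_{q L_{ε₀}(p)}, |C(0)| < ∞) ≤ C e^{-c q}` for all `p < 1/2` with `L_{ε₀}(p) ≥ 1` and
`q ≥ 1`, and if `1 ≤ L_{ε₀}(p) ≤ M L_ε(p)` whenever `p < 1/2` and `L_ε(p) ≥ 1`, then
`P_p(0 ↝ ∂S_{k L_ε(p)}, |C(0)| < ∞) ≤ max C 1 · e^{c} · e^{-(c/M) k}` for all such `p` and `k ≥ 1`:
with `q = ⌊k / M⌋`, `S_{q L_{ε₀}} ⊆ S_{k L_ε}` (monotonicity of the arm events, `triBoxArm_anti`)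
and `c q ≥ (c / M) k - c`; for `q = 0` the bound exceeds `1`. This is the (elementary) way the
equivalence of lengths transports Nolin's Lemma 39 / the annulus display from one `ε` to another
("The result for any `ε ∈ (0,1/2)` follows readily by using the equivalence of lengths"). [cite: Nolin2008, §7.4, end of the proof of Lemma 39 (arXiv 0711.4948: Lemma 37, p. 26)] -/
theorem Nolin2008_radius_decay_subcritical_at_of_charLength_le {ε ε₀ : ℝ} {M : ℕ} (hM : 1 ≤ M)
    (h₀ : Nolin2008_radius_decay_subcritical_at ε₀)
    (hcmp : ∀ p : unitInterval, (p : ℝ) < 1 / 2 → 1 ≤ charLength ε p →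
      1 ≤ charLength ε₀ p ∧ charLength ε₀ p ≤ M * charLength ε p) :
    Nolin2008_radius_decay_subcritical_at ε := by
  obtain ⟨C, hC, c, hc, h⟩ := h₀
  refine ⟨max C 1 * Real.exp c, by positivity, c / M, by positivity, fun p hp hL k hk => ?_⟩
  obtain ⟨hL₀, hle⟩ := hcmp p hp hL
  have hMpos : (0 : ℝ) < M := by exact_mod_cast hM
  set q := k / M with hq
  -- `k ≤ M q + M`, hence `e^{-c q} ≤ e^{c} e^{-(c/M) k}`
  have hqk : (k : ℝ) ≤ M * q + M := by
    have h1 : M * q + k % M = k := by rw [hq]; exact Nat.div_add_mod k M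
    have h2 := Nat.mod_lt k (show 0 < M by omega)
    exact_mod_cast (show k ≤ M * q + M by omega)
  have hexp : Real.exp (-(c * q)) ≤ Real.exp c * Real.exp (-(c / M * k)) := by
    rw [← Real.exp_add]
    refine Real.exp_le_exp.2 ?_
    have hk' : c / M * k ≤ c * q + c := by
      rw [div_mul_eq_mul_div, div_le_iff₀ hMpos]
      nlinarith [mul_le_mul_of_nonneg_left hqk hc.le]
    linarith
  rcases Nat.eq_zero_or_pos q with hq0 | hq1
  · -- `k < M`: the bound exceeds `1`
    calc (triSitePercolation p).real
          (triBoxArm (k * charLength ε p) ∩ (sitePercolatesAt triGraph 0)ᶜ)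
        ≤ 1 := measureReal_le_one
      _ = 1 * Real.exp (-(c * q)) := by
          rw [hq0, Nat.cast_zero, mul_zero, neg_zero, Real.exp_zero, mul_one]
      _ ≤ max C 1 * (Real.exp c * Real.exp (-(c / M * k))) := by
          gcongr
          exact le_max_right _ _
      _ = max C 1 * Real.exp c * Real.exp (-(c / M * k)) := by ring
  · -- `q ≥ 1`: `S_{q L_{ε₀}} ⊆ S_{k L_ε}`
    have hsub : triBoxArm (k * charLength ε p) ⊆ triBoxArm (q * charLength ε₀ p) := by
      refine triBoxArm_anti (le_trans hL₀ (Nat.le_mul_of_pos_left _ hq1)) ?_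
      calc q * charLength ε₀ p ≤ q * (M * charLength ε p) := Nat.mul_le_mul_left _ hle
        _ = q * M * charLength ε p := by ring
        _ ≤ k * charLength ε p := Nat.mul_le_mul_right _ (Nat.div_mul_le_self k M)
    calc (triSitePercolation p).real
          (triBoxArm (k * charLength ε p) ∩ (sitePercolatesAt triGraph 0)ᶜ)
        ≤ (triSitePercolation p).real
            (triBoxArm (q * charLength ε₀ p) ∩ (sitePercolatesAt triGraph 0)ᶜ) :=
          measureReal_mono (inter_subset_inter_left _ hsub) (measure_ne_top _ _)
      _ ≤ C * Real.exp (-(c * q)) := h p hp hL₀ q hq1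
      _ ≤ max C 1 * (Real.exp c * Real.exp (-(c / M * k))) := by
          gcongr
          exact le_max_left _ _
      _ = max C 1 * Real.exp c * Real.exp (-(c / M * k)) := by ring

/-- **From a left neighbourhood of `1/2` to all `p < 1/2`.** If `L_{ε₀}(p) ≤ M L_ε(p)` for
`1/2 - δ < p < 1/2` (`0 < ε₀ ≤ ε`), then `1 ≤ L_{ε₀}(p) ≤ M' L_ε(p)` for every `p < 1/2` with
`L_ε(p) ≥ 1`: `L_ε ≤ L_{ε₀}` (the scale `L_{ε₀}(p)` has crossing probability `≤ ε₀ ≤ ε`), and for `p ≤ 1/2 - δ` the length `L_{ε₀}(p)` is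
bounded by its value at the fixed parameter `t = 1/2 - min δ (1/2) / 2` (`L_ε` is non-decreasing
in `p` on `[0, 1/2)`, `charLength_le_charLength`; finiteness of `L_ε` from
`Nolin2008_subcritical_crossing_holds`). [cite: Nolin2008, §3.1 (definition and monotonicity properties of L_ε); §7.3 proof of Cor. 37 (arXiv 0711.4948: Cor. 35)] -/
theorem charLength_le_mul_charLength_of_eventually {ε ε₀ : ℝ} (hε₀ : 0 < ε₀) (hle : ε₀ ≤ ε) {δ : ℝ}
    (hδ : 0 < δ) {M : ℕ}
    (hM : ∀ p : unitInterval, 1 / 2 - δ < (p : ℝ) → (p : ℝ) < 1 / 2 →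
      charLength ε₀ p ≤ M * charLength ε p) :
    ∃ M' : ℕ, 1 ≤ M' ∧ ∀ p : unitInterval, (p : ℝ) < 1 / 2 → 1 ≤ charLength ε p →
      1 ≤ charLength ε₀ p ∧ charLength ε₀ p ≤ M' * charLength ε p := by
  have hsub := Nolin2008_subcritical_crossing_holds
  -- the fixed parameter `t = 1/2 - δ'/2`, `δ' = min δ (1/2)`
  set δ' : ℝ := min δ (1 / 2) with hδ'
  have hδ'0 : 0 < δ' := lt_min hδ (by norm_num)
  have hδ'δ : δ' ≤ δ := min_le_left _ _
  have hδ'h : δ' ≤ 1 / 2 := min_le_right _ _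
  have htI : (1 / 2 - δ' / 2 : ℝ) ∈ Icc (0 : ℝ) 1 := by constructor <;> linarith
  set t : unitInterval := ⟨1 / 2 - δ' / 2, htI⟩ with ht
  have htlt : ((t : unitInterval) : ℝ) < 1 / 2 := by simp only [ht]; linarith
  set B : ℕ := charLength ε₀ t with hB
  refine ⟨max (max M B) 1, le_max_right _ _, fun p hp hL => ?_⟩
  -- `L_ε(p) ≤ L_{ε₀}(p)`: the scale `L_{ε₀}(p)` already has crossing probability `≤ ε₀ ≤ ε`
  have hanti : charLength ε p ≤ charLength ε₀ p := by
    have hmem : charLength ε₀ p ∈ {n : ℕ | triLRCrossingProb (min p (σ p)) n n ≤ ε} := by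
      rw [mem_setOf_eq, min_symm_eq_self hp.le]
      exact (triLRCrossingProb_charLength_le' hsub hε₀ hp).trans hle
    exact Nat.sInf_le hmem
  have hL₀ : 1 ≤ charLength ε₀ p := hL.trans hanti
  refine ⟨hL₀, ?_⟩
  by_cases hnear : 1 / 2 - δ < (p : ℝ)
  · calc charLength ε₀ p ≤ M * charLength ε p := hM p hnear hp
      _ ≤ max (max M B) 1 * charLength ε p :=
          Nat.mul_le_mul_right _ ((le_max_left _ _).trans (le_max_left _ _))
  · have hpt : p ≤ t := Subtype.coe_le_coe.1 (by simp only [ht]; push Not at hnear; linarith)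
    calc charLength ε₀ p ≤ B := charLength_le_charLength hsub hε₀ hpt htlt
      _ = B * 1 := (mul_one B).symm
      _ ≤ max (max M B) 1 * charLength ε p :=
          Nat.mul_le_mul ((le_max_right _ _).trans (le_max_left _ _)) hL

/-- **Every `ε ∈ (0, 1/2)` from small `ε` and the comparison of lengths** (the architecture of
Nolin's proof of Lemma 39, transported to the annulus display): if the subcritical radius decay
holds at every `ε ≤ ε₁` (`ε₁ > 0`; step (i), RSW and the block argument) and if, for
`0 < ε₀ ≤ ε < 1/2`, `L_{ε₀}(p) ≤ M L_ε(p)` on a left neighbourhood of `1/2` (the non-trivial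
direction of Nolin's Cor. 37 [arXiv: Cor. 35], `L_ε ≍ L_{ε'}`, here a HYPOTHESIS), then
`Nolin2008_radius_decay_subcritical` holds. [cite: Nolin2008, §7.4, end of the proof of Lemma 39 (arXiv 0711.4948: Lemma 37, p. 26); §7.3 Cor. 37 (arXiv: Cor. 35)] -/
theorem Nolin2008_radius_decay_subcritical_of_small_of_lengths {ε₁ : ℝ} (hε₁ : 0 < ε₁)
    (hsmall : ∀ ε : ℝ, ε ≤ ε₁ → Nolin2008_radius_decay_subcritical_at ε)
    (hlen : ∀ ⦃ε₀ ε : ℝ⦄, 0 < ε₀ → ε₀ ≤ ε → ε < 1 / 2 →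
      ∃ δ > (0 : ℝ), ∃ M : ℕ, ∀ p : unitInterval, 1 / 2 - δ < (p : ℝ) → (p : ℝ) < 1 / 2 →
        charLength ε₀ p ≤ M * charLength ε p) :
    Nolin2008_radius_decay_subcritical := by
  intro ε _hε hε'
  by_cases hsm : ε ≤ ε₁
  · exact hsmall ε hsm
  · push Not at hsm
    obtain ⟨δ, hδ, M, hM⟩ := hlen hε₁ hsm.le hε'
    obtain ⟨M', hM', hcmp⟩ := charLength_le_mul_charLength_of_eventually hε₁ hsm.le hδ hM
    exact Nolin2008_radius_decay_subcritical_at_of_charLength_le hM' (hsmall ε₁ le_rfl) hcmp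

/-- **`Nolin2008_radius_decay_subcritical` from the RSW theorem and the equivalence of lengths**
(Nolin's proof of Lemma 39 as printed, steps (i) and (ii), followed by the annulus display):
`Nolin2008_RSW_one` and the non-trivial direction of Cor. 37 [arXiv: Cor. 35] near `1/2⁻` imply the
subcritical radius decay beyond `L_ε(p)` for every `ε ∈ (0, 1/2)`. [cite: Nolin2008, §7.4 Lemma 39 with its proof (arXiv 0711.4948: Lemma 37, p. 26); §7.3 Cor. 37 (arXiv: Cor. 35); §7.5 proof of Lemma 44 (arXiv: Lemma 42)] -/
theorem Nolin2008_radius_decay_subcritical_of_RSW_one_of_lengths (h : Nolin2008_RSW_one)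
    (hlen : ∀ ⦃ε₀ ε : ℝ⦄, 0 < ε₀ → ε₀ ≤ ε → ε < 1 / 2 →
      ∃ δ > (0 : ℝ), ∃ M : ℕ, ∀ p : unitInterval, 1 / 2 - δ < (p : ℝ) → (p : ℝ) < 1 / 2 →
        charLength ε₀ p ≤ M * charLength ε p) :
    Nolin2008_radius_decay_subcritical := by
  obtain ⟨ε₀, hε₀, hsmall⟩ := Nolin2008_radius_decay_subcritical_at_of_RSW_one h
  exact Nolin2008_radius_decay_subcritical_of_small_of_lengths hε₀ hsmall hlen

/-! ### After the unconditional start: small `ε` outright, every `ε` from the lengths alone -/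

/-- **The subcritical radius decay at every small `ε`, proved** (Nolin 2008, §7.5, proof of
Lemma 44 [arXiv 0711.4948: Lemma 42], first annulus display, for the `ε` "given by RSW" of the
proof of Lemma 39 [arXiv: Lemma 37, p. 26: "we have proved the property for any `ε` below some
fixed value `ε₀`"]): there is `ε₀ > 0` such that `Nolin2008_radius_decay_subcritical_at ε` holds for
every `ε ≤ ε₀` — the tree's unconditional `Nolin2008_lemma39_at_holds_small`
(`NearCriticalRSWStart.lean`) followed by the annulus display
`Nolin2008_radius_decay_subcritical_at_of_lemma39_at`. This is the body of the named fact
`Nolin2008_radius_decay_subcritical` for these `ε`; the remaining `ε ∈ (ε₀, 1/2)` need exactly the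
non-trivial inequality of Cor. 37 (`Nolin2008_radius_decay_subcritical_of_lengths`). [cite: Nolin2008, §7.5, proof of Lemma 44 (arXiv 0711.4948: Lemma 42), with §7.4 Lemma 39 / Remark 40 (arXiv: Lemma 37 / Remark 38)] -/
theorem Nolin2008_radius_decay_subcritical_at_holds_small :
    ∃ ε₀ > (0 : ℝ), ∀ ε : ℝ, ε ≤ ε₀ → Nolin2008_radius_decay_subcritical_at ε := by
  obtain ⟨ε₀, hε₀, h⟩ := Nolin2008_lemma39_at_holds_small
  exact ⟨ε₀, hε₀, fun ε hε => Nolin2008_radius_decay_subcritical_at_of_lemma39_at (h ε hε)⟩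

/-- **`Nolin2008_radius_decay_subcritical` for every `ε ∈ (0, 1/2)` from the equivalence of
lengths alone** (Nolin 2008, proof of Lemma 39, last paragraph: "The result for any `ε ∈ (0,1/2)`
follows readily by using the equivalence of lengths for different values of `ε`", then the first
annulus display of the proof of Lemma 44): if for all `0 < ε₀ < ε < 1/2` there are `δ > 0` and `C`
with `L_{ε₀}(p) ≤ C · L_ε(p)` for `1/2 - δ < p < 1/2` (the non-trivial inequality of Cor. 37
[arXiv: Cor. 35], in the shape produced by `charLength_lengths_of_prop34`), then the fact holds —
`Nolin2008_radius_decay_subcritical_of_lemma39` with `Nolin2008_lemma39_of_lengths`. [cite: Nolin2008, §7.4, proof of Lemma 39, last paragraph (arXiv 0711.4948: Lemma 37, p. 26); §7.3 Cor. 37 (arXiv: Cor. 35); §7.5 proof of Lemma 44 (arXiv: Lemma 42)] -/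
theorem Nolin2008_radius_decay_subcritical_of_lengths
    (hlen : ∀ ⦃ε₀ ε : ℝ⦄, 0 < ε₀ → ε₀ < ε → ε < 1 / 2 →
      ∃ δ > (0 : ℝ), ∃ C : ℝ, ∀ p : unitInterval, 1 / 2 - δ < (p : ℝ) → (p : ℝ) < 1 / 2 →
        (charLength ε₀ p : ℝ) ≤ C * charLength ε p) :
    Nolin2008_radius_decay_subcritical :=
  Nolin2008_radius_decay_subcritical_of_lemma39 (Nolin2008_lemma39_of_lengths hlen)

/-- The same from the `ℕ`-shaped comparison `L_{ε₀}(p) ≤ M · L_ε(p)` (`0 < ε₀ ≤ ε < 1/2`, `p` just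
below `1/2`) consumed by `Nolin2008_radius_decay_subcritical_of_small_of_lengths`, whose first
hypothesis is now the theorem `Nolin2008_radius_decay_subcritical_at_holds_small`. [cite: Nolin2008, §7.4, proof of Lemma 39, last paragraph (arXiv 0711.4948: Lemma 37, p. 26); §7.3 Cor. 37 (arXiv: Cor. 35)] -/
theorem Nolin2008_radius_decay_subcritical_of_lengths'
    (hlen : ∀ ⦃ε₀ ε : ℝ⦄, 0 < ε₀ → ε₀ ≤ ε → ε < 1 / 2 →
      ∃ δ > (0 : ℝ), ∃ M : ℕ, ∀ p : unitInterval, 1 / 2 - δ < (p : ℝ) → (p : ℝ) < 1 / 2 →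
        charLength ε₀ p ≤ M * charLength ε p) :
    Nolin2008_radius_decay_subcritical := by
  obtain ⟨ε₀, hε₀, hsmall⟩ := Nolin2008_radius_decay_subcritical_at_holds_small
  exact Nolin2008_radius_decay_subcritical_of_small_of_lengths hε₀ hsmall hlen

/-- **`Nolin2008_radius_decay_subcritical` from Kesten's relation and the two critical four-arm
inputs of the printed proof of Cor. 37** (`|p - 1/2| L_ε² π₄(L_ε) ≍ 1`, quasi-multiplicativity,
`π₄(L_{ε'}, L_ε) ≥ C₃ (L_{ε'}/L_ε)^{2-α'}`): the named facts `Nolin2008_prop34`,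
`Werner2009_fourArm_quasiMult`, `Werner2009_fourArm_lowerBound` imply the fact for every
`ε ∈ (0, 1/2)` (`charLength_lengths_of_prop34`); no Russo–Seymour–Welsh input at `p ≠ 1/2`. [cite: Nolin2008, §7.3 Prop. 34 and Cor. 37, §7.4 Lemma 39, §7.5 proof of Lemma 44 (arXiv 0711.4948: Prop. 32, Cor. 35, Lemma 37, Lemma 42)] [cite: WernerPCMI2009, Lecture 6, Cor. 6.2 and §3] -/
theorem Nolin2008_radius_decay_subcritical_of_scaling (hK : Nolin2008_prop34)
    (hQM : Werner2009_fourArm_quasiMult) (hLB : Werner2009_fourArm_lowerBound) :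
    Nolin2008_radius_decay_subcritical :=
  Nolin2008_radius_decay_subcritical_of_lengths (charLength_lengths_of_prop34 hK hQM hLB)

/-- **`Nolin2008_radius_decay_subcritical` from its three current leaves** — Werner's pivotal
count below `L(p)` `Werner2009_lemma62` (whence Kesten's relation, `Nolin2008_prop34_of_expDecay`
with `BollobasRiordan2006_tri_expDecay_holds`), `Werner2009_fourArm_quasiMult` and
`Werner2009_fourArm_lowerBound` (`Nolin2008_lemma39_of_lemma62`). The discharge
`Nolin2008_radius_decay_subcritical_holds` is this theorem applied to their three `_holds`. [cite: Nolin2008, §7.3 Prop. 34 and Cor. 37, §7.4 Lemma 39, §7.5 proof of Lemma 44 (arXiv 0711.4948: Prop. 32, Cor. 35, Lemma 37, Lemma 42)] [cite: WernerPCMI2009, Lecture 6, Lemma 6.2, Cor. 6.2, Cor. 6.3 and §3] -/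
theorem Nolin2008_radius_decay_subcritical_of_lemma62 (h62 : Werner2009_lemma62)
    (hQM : Werner2009_fourArm_quasiMult) (hLB : Werner2009_fourArm_lowerBound) :
    Nolin2008_radius_decay_subcritical :=
  Nolin2008_radius_decay_subcritical_of_lemma39 (Nolin2008_lemma39_of_lemma62 h62 hQM hLB)

/-! ### After the discharge of two of Werner's four facts -/

/-- **`Nolin2008_radius_decay_subcritical` from Werner's rhombus pivotal count and the
quasi-multiplicativity of four arms** — `Nolin2008_radius_decay_subcritical_of_lemma62` with its
third input, the a-priori lower bound `π̂_t(m, n) ≥ c (m/n)^{2-β}` below `L(p)`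
(`Werner2009_fourArm_lowerBound`, Werner 2009, Lecture 6, §3, third estimate), supplied by the
theorem `Werner2009_fourArm_lowerBound_holds` (`FiveArmLowerBound.lean`). [cite: Nolin2008, §7.3 Prop. 34 and Cor. 37, §7.4 Lemma 39, §7.5 proof of Lemma 44 (arXiv 0711.4948: Prop. 32, Cor. 35, Lemma 37, Lemma 42)] [cite: WernerPCMI2009, Lecture 6, Lemma 6.2, Cor. 6.2 and §3] -/
theorem Nolin2008_radius_decay_subcritical_of_lemma62_of_quasiMult (h62 : Werner2009_lemma62)
    (hQM : Werner2009_fourArm_quasiMult) : Nolin2008_radius_decay_subcritical :=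
  Nolin2008_radius_decay_subcritical_of_lemma62 h62 hQM Werner2009_fourArm_lowerBound_holds

/-- **`Nolin2008_radius_decay_subcritical` for every `ε ∈ (0, 1/2)` from the two remaining named
facts of the near-critical arm calculus** (Nolin 2008, §7.5, proof of Lemma 44 [arXiv 0711.4948:
Lemma 42], first annulus display `P_p(∂S_L ↝ ∂S_{kL}) ≤ C₃ e^{-C₄ k}` for `p < 1/2`, `L = L_ε(p)`,
through Lemma 39 / Remark 40 at every `ε`, i.e. through the equivalence of lengths Cor. 37):
`Werner2009_fourArm_quasiMult` (Werner 2009, Lecture 6, Cor. 6.2) and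
`Werner2009_pivotal_lowerBound` (proof of Lemma 6.2, lower bound) imply the fact —
`Nolin2008_radius_decay_subcritical_of_lemma39` with `Nolin2008_lemma39_of_facts4`
(`KestenScalingThetaFromFourFacts.lean`), the other two of Werner's four facts — the a-priori
four-arm lower bound (§3, third estimate) and the near-critical half-plane two-arm bound (§3 ¶1) —
entering as the theorems `Werner2009_fourArm_lowerBound_holds` and
`Werner2009_halfPlane_twoArm_holds` (as in `Nolin2008_lemma39_of_facts2`,
`KestenScalingThetaFromTwoFacts.lean`). The discharge `Nolin2008_radius_decay_subcritical_holds` is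
this theorem applied to the two `_holds` once they land. [cite: Nolin2008, §7.5, proof of Lemma 44, first annulus display; §7.4 Lemma 39 / Remark 40; §7.3 Prop. 34 and Cor. 37 (arXiv 0711.4948: Lemma 42; Lemma 37 / Remark 38; Prop. 32, Cor. 35)] [cite: WernerPCMI2009, Lecture 6, Cor. 6.2 and proof of Lemma 6.2] -/
theorem Nolin2008_radius_decay_subcritical_of_facts2 (hQM : Werner2009_fourArm_quasiMult)
    (hP : Werner2009_pivotal_lowerBound) : Nolin2008_radius_decay_subcritical :=
  Nolin2008_radius_decay_subcritical_of_lemma39 (Nolin2008_lemma39_of_facts4 hQM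
    Werner2009_fourArm_lowerBound_holds Werner2009_halfPlane_twoArm_holds hP)

end Literature.Probability.Percolation
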